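import Mathlib
import HarnessLib
import HarnessLib.Audit
import Summits.FinalStateConjecture.Statement
import Literature.Geometry.Lorentzian.LocFinalStateSettling
import Literature.Geometry.Lorentzian.KerrSurfaceGravity

/-!
Route: SpectralSurfaceGravity

DORMANT since 2026-09-04T18:00:19Z (reconciler: no traction for 5 d (last activity statement-checked at 2026-08-30T17:26:59Z); parked, not closed — `ledger route dormant route-FinalStateConjecture-SpectralSurfaceGravity --off` to reacti) — unstaffed, not closed; items shared with open routes are served there. `ledger route dormant <id> --off` reactivates.

# Route SpectralSurfaceGravity — surface gravity without a Killing field — the MOTS pencil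
eigenvalue is the order parameter that decides sub-extremality

It suffices to show X = U ∧ K ∧ T ∧ G (plus the shared support S). Card realised:
quasilocal-surface-gravity-mots-redshift.
On a spherical MOTS section S with null normal pair (ℓ, k), g(ℓ,k) = −2, ℓ normalised by the chart
clock dt*(ℓ) = 1, the QUASI-LOCAL
SURFACE GRAVITY κ_ql(S) is the principal eigenvalue of the pencil δ_{ψ(−k)}θ^{(ℓ)} = κ·(−θ^{(k)})·ψ
(Andersson–Mars–Simon null-inward
stability operator against the weight −θ^{(k)} > 0); "κ_ql(S) ≥ κ" is typed as a positive
supersolution ψ realised by a jointly C³ deformation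
with velocity −ψk (ψ ∈ C², classical first variation — refuter repair 2026-08-15;
AnderssonMarsSimon2008 Lemma 3.1–3.2, Lemma 4.1, Prop. 5.1). A hole of a typed
`FinalStateDecomposition` has a
RED-SHIFTED COLLAR when its Kerr–Schild chart extends across r = r₊ to {|r − r₊| < η} (C⁴ open
embedding, eventually uniform C³
metric bounds and non-degeneracy) and the extended t*-slices carry a C⁴-bounded achronal tube of
spherical marginally trapped sections,
asymptotically not inside the reference horizon radius, with κ_ql ≥ κ > 0 uniformly (ψ ∈ [m,1]). U
(HorizonSubextremal, card
consequence (ii)): for EVERY admissible datum and MGHD, a typed exhaustive (honest radii),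
future-oriented C² settling on the self-determined exterior, with every
future-complete null ray from the data in its closure (re-typed Statement p126844), with |aᵢ| ≤ Mᵢ
whose holes all have red-shifted collars forces |aᵢ| < Mᵢ, i.e. the Statement's settling clause. K
(LinearRedShift, card K1 for
□_g): the Dafermos–Rodnianski red-shift/slaving energy estimate in any NEC collar around an
achronal, oriented (ingoing normal inward) MOTT with κ_ql ≥ κ > 0,
constants depending only on (κ, m, geometry) — no Killing field, no background. T (KerrCalibration,
card P3): on Kerr–Schild Kerr, |a| ≤ M, the
horizon sections have κ_ql = κ(M,a) = √(M²−a²)/(r₊²+a²) exactly (Jaramillo2012 Lemma 1; = 0 iff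
extremal), so κ_ql > 0 ⇔ `Kerr.IsSubextremal`. G
(GenericRedShiftedSettling, card K2+K3 + the settling/censorship front end as ONE generic
statement): TAME-Christodoulou-generically (one fixed end,
`IsTameChristodoulouGeneric`) every MGHD has complete 𝓘⁺, settles in the re-typed sense with |aᵢ| ≤
Mᵢ, and every hole has a red-shifted collar. S: MGHDExists.
Lean: `HorizonSubextremal ∧ LinearRedShift ∧ KerrCalibration ∧ GenericRedShiftedSettling ∧
MGHDExists`

## Assembly
Pure logic, PROVED sorry-free as `closes` in glue.lean / Sketch.lean (lean check rc 0): tame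
Christodoulou codimension is antitone in the
exceptional set — if Q → P pointwise on the admissible class then `IsTameChristodoulouGeneric 𝓓 Q 1
→ IsTameChristodoulouGeneric 𝓓 P 1` (the same one-ended tame immersed witness family serves). Take
Q = the generic property of GenericRedShiftedSettling and P = the Statement's property: for
admissible D with Q D, MGHDExists gives the
MGHD (anti-vacuity conjunct); for every MGHD, Q gives complete 𝓘⁺ and the typed settling with
red-shifted collars, and HorizonSubextremal
turns the latter into the sub-extremal, rays-closed, exhaustive, future-oriented C² decomposition —
verbatim the re-typed Statement's second conjunct. LinearRedShift and
KerrCalibration are the mechanism's stand-alone tests and ride as unused hypotheses of `closes`.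

Rationale: WHY THIS LINE. Surface gravity is the one number the red-shift estimate consumes
(DafermosRodnianski2008 §3.3 and Thm 7.1: the construction "depends only
on the positivity of" κ; DafermosRodnianski2005), and κ = 0 is exactly where horizons misbehave
(Aretakis), but on a dynamical horizon
there is no Killing field to define κ; the card's move is to DEFINE it quasi-locally as the bottom
of the spectrum of the null-inward
MOTS stability operator (AnderssonMarsSimon2008; on isolated horizons this IS κ: Jaramillo2012 Lemma
1, BoothFairhurst2007, Mars2012) and to
read off (a) the red-shift/slaving estimate from spectral positivity alone (K;
DafermosRodnianski2003 have a dynamical red-shift only in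
spherical symmetry via ϖ, DafermosHolzegelRodnianskiTaylor2021 and KlainermanSzeftel2023 only by
closeness to Kerr) and (b) the
Statement's `Kerr.IsSubextremal` clause as the positivity of a slice-computable order parameter on
the late tube (U, T), leaving the
generic third law in the tractable form "generic absorbed flux pushes λ₀ up" (G). Imported areas:
spectral theory of non-self-adjoint
elliptic operators (Donsker–Varadhan / Krein–Rutman principal eigenvalue, AMS Lemma 4.1),
quasi-local horizon geometry (isolated and
dynamical horizons), the vector-field method. What it does that the 40 open FSC routes do not (grep
2026-08-15: none uses a MOTS
stability operator or defines κ without a Killing field; TwoBoundarySqueeze.SubextremalUpgradeC2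
ASSUMES sub-extremal C⁰ labels and
TwoBoundarySqueeze.GenericCensorshipThirdLaw phrases the third law through C⁰ endpoint labels;
CriticalAncestry uses outermost MOTS only
to count holes): sub-extremality is decided by a geometric quantity computed on one slice at a time,
for ALL data (U), with an exact
Kerr dictionary (T) and a stand-alone PDE test of the mechanism (K); negatives index empty at
filing.

RANKED CRUXES. #2 HorizonSubextremal (crux) — (card consequence (ii), deciding form) For every
connected Hausdorff second-countable 3-manifold X,
every admissible vacuum datum D and every MGHD 𝒟 of D: suppose some region O carries an N-black-hole
`FinalStateDecomposition d` in C² (boosted Kerr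
near zones, 0 < Mᵢ, |aᵢ| ≤ Mᵢ, flat radiation zone, separation, covering) with O = J⁺(ιX) ∩
I⁻(d.charted), rays staying in closure O, exhaustive
charts with honest radii and future-oriented chart times (`RaysStayInClosure`,
`HasExhaustiveCharts`, `IsFutureOriented`: the re-typed Statement's
clauses, p126844), and suppose every hole i has a RED-SHIFTED COLLAR — an extension Φ of the
rest-frame Kerr–Schild chart to the collar {t* > τ₀, |r −
r₊(Mᵢ,aᵢ)| < η} (C⁴ open embedding; on {t* ≥ τ₁} the pulled-back metric is honestly C³-bounded by B,
its t*-slices are uniformly spacelike (≥ b|v|²)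
and it admits a unit vector with g ≤ −b) and a radial-graph tube of spheres n ↦ Φ(τ, ρ(τ,n)·n) in
the collar slices (ρ C⁴-bounded by B), achronal,
eventually above r₊ − ε in Kerr–Schild radius for every ε > 0, whose sections are marginally trapped
(θ_ℓ = 0, θ_k < 0) for a null pair with dt*(ℓ) =
1, g(ℓ,k) = −2 and admit ψ ∈ [m,1] and a jointly C³ deformation with velocity −ψk (ψ ∈ C², classical
first variation; refuter repair 2026-08-15) along
which d/ds θ^{(ℓ)} ≥ κ·(−θ^{(k)})·ψ, with κ > 0, i.e. λ₀ ≥ κ for the null-inward pencil — then some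
region O′ carries a C² `FinalStateDecomposition`
all of whose holes are SUB-extremal, O′ = J⁺(ιX) ∩ I⁻(charted), rays staying in closure O′,
exhaustive honest charts and future orientation: verbatim
the re-typed Statement's clause (ii) for 𝒟 (intended: O′ = O, same d). Intended proof: if |aᵢ| = Mᵢ,
late sections subconverge (C⁴/C³ bounds) to a
MOTS of a t*-slice of EXTREMAL Kerr in {r ≥ M}, hence to the horizon section, whose pencil
eigenvalue is κ(M,M) = 0 by KerrCalibration (typed for |a|
≤ M) — contradicting u.s.c. of the principal eigenvalue (≥ κ > 0). [deps: KerrCalibration]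
[difficulty: L] (why it might fail: A red-shifted MOTS tube
might hide strictly inside 𝓗⁺ of an asymptotically extremal hole (interior geometry is only
C³-bounded, not Kerr); the step needs upper semicontinuity
of the pencil eigenvalue under C² limits of sections and uniqueness of MOTS near r = M in extremal
Kerr slices.) [AnderssonMarsSimon2008,
Jaramillo2012, BoothFairhurst2007, Mars2012, AnderssonMetzger2009, Aretakis2015,
DafermosHolzegelRodnianskiTaylor2021] #3 LinearRedShift (crux) —
(card K1 for □_g, the mechanism's PDE test) For all constants (r₀, η, κ, m, b, B) there are η′ ∈ (0,
η), C₀ and c₀ > 0 such that: for EVERY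
time-oriented spacetime (M, g), every collar chart Φ of {x⁰ > τ₁ − 1, |‖x‖ − r₀| < η} (C⁴ open
embedding, Φ^*g honestly C³-bounded by B, slices {x⁰ =
c} uniformly spacelike ≥ b|v|², a unit vector with g ≤ −b, null energy condition on the image),
every radial-graph tube ρ (C⁴-bounded by B, |ρ − r₀| <
η/2) which is achronal and whose sections are marginally trapped for the clock-normalised pair
(dx⁰(ℓ) = 1, g(ℓ,k) = −2) which is ORIENTED — the chart
preimage of the ingoing normal k points to decreasing |y| (refuter repair 2026-08-15: the unoriented
statement is killed by the radially inverted
Schwarzschild collar chart) — with a pencil supersolution ψ ∈ [m,1] realised by a jointly C³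
deformation (ψ ∈ C², classical first variation),
δ_{ψ(−k)}θ^{(ℓ)} ≥ κ(−θ^{(k)})ψ, and every C² solution of □_g φ = 0 on the collar: for τ₁ ≤ σ ≤ τ₂
the coordinate energy ∫|∂(φ∘Φ)|² on the inner shell
{ρ < |y| < ρ + η′} at time τ₂ is ≤ C₀e^{−c₀(τ₂−σ)}·(energy on {ρ < |y| < r₀+η} at σ) +
C₀·sup_{[σ,τ₂]}(energy on {ρ+η′ ≤ |y| < r₀+η}) — exponential
forgetting of the collar, slaved to the bulk, with no Killing field and no background. [difficulty:
L] (why it might fail: DR's K^N ≥ bJ^N uses the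
POINTWISE inaffinity of a Killing generator (no shear); here positivity is only spectral and a
dynamical MOTT shears: the ψ-weighted current may lose
coercivity when osc(ψ) or transient shear is large vs κ (strongly accreting Vaidya keeps κ_ql = 1/4m
> 0).) [DafermosRodnianski2008,
DafermosRodnianski2005, DafermosRodnianski2003, arXiv:1509.08495, AnderssonMarsSimon2008,
BoothFairhurst2007] #4 KerrCalibration (crux) — (card P3,
the dictionary line κ ↦ λ₀ made exact) For Kerr with 0 < M, |a| ≤ M (sub-extremal AND extremal;
widened 2026-08-16 so that the extremal calibration λ₀
= κ(M,M) = 0 used by HorizonSubextremal is delivered) in ingoing Kerr–Schild coordinates on {r >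
r₀}, 0 < r₀ < r₊, and every τ: the horizon section
S_τ = {t* = τ, r = r₊}, parametrised from the unit sphere by n ↦ (τ, r₊n₀ − a n₁, r₊n₁ + a n₀,
r₊n₂), is marginally trapped for a clock-normalised
null pair (ℓ⁰ = 1, i.e. ℓ = the Hawking generator T + ω₊Φ; g(ℓ,k) = −2), and for every κ′ the
null-inward pencil admits a positive supersolution at
level κ′ (a jointly C³ deformation with velocity −ψk, ψ > 0 — hence ψ ∈ C² and d/ds θ^{(ℓ)}|₀ = L[ψ]
classically; refuter repair 2026-08-15, with C²
families the '→' half was false — d/ds θ^{(ℓ)} ≥ κ′(−θ^{(k)})ψ) IFF κ′ ≤ `Kerr.surfaceGravity M a` =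
√(M²−a²)/(r₊²+a²) (= 0 at |a| = M): the pencil
eigenvalue of the Kerr horizon is its surface gravity (eigenfunction: Jaramillo's e^{2λ} from the
Hodge decomposition of the rotation 1-form). Hence
κ_ql > 0 ⇔ `Kerr.IsSubextremal` and κ_ql = 0 ⇔ extremal on exact Kerr (surfaceGravity_pos_iff,
IsExtremal.surfaceGravity_eq_zero); known content:
Jaramillo2012 Lemma 1, Mars2012 Cor. 1–2, AMS2008 Lemma 4.1–4.2; Schwarzschild by hand: ℓ = ∂_v, k =
−2∂_r, θ_k = −2/M, δ_{−k}θ_ℓ = 1/(2M²) = κ·(−θ_k)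
with κ = 1/4M. [difficulty: M] (why it might fail: Jaramillo's Lemma 1 is for ℓ·k = −1 and the
divergence-free ℓ_o; transport to the clock
normalisation dt*(ℓ) = 1, g(ℓ,k) = −2 must not pick up a factor (claimed: eigenfunction ψ_J², same
eigenvalue); sharpness needs uniqueness of positive
pencil eigenfunctions (Krein–Rutman for w⁻¹L).) [Jaramillo2012, Mars2012, BoothFairhurst2007,
AnderssonMarsSimon2008, Wald1984GR,
DafermosRodnianski2008] #5 GenericRedShiftedSettling (crux) — (card K2+K3 + the settling/censorship
front end; ONE generic statement because
Christodoulou genericity is not closed under ∧) For every X, TAME-Christodoulou-generically in the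
admissible class (`IsTameChristodoulouGeneric … 1`,
re-typed Statement p126844: the exceptional set is avoided by an injective one-parameter family of
admissible data on ONE fixed asymptotically flat
end, jointly smooth, wDist-continuous and immersed at c = 0): every MGHD has complete 𝓘⁺ (sojourn
form) AND some region O carries an exhaustive C²
`FinalStateDecomposition` (finitely many boosted Kerrs with |aᵢ| ≤ Mᵢ plus radiation, O = J⁺(ιX) ∩
I⁻(charted), every future-complete normalised null
ray from the data in closure O, honest growing near-zone radii, future-oriented chart times —
`RaysStayInClosure`, `HasExhaustiveCharts`,
`IsFutureOriented` as in the Statement) every hole of which has a red-shifted collar in the sense of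
HorizonSubextremal (C⁴ extended Kerr–Schild
collar chart with eventual uniform C³ metric bounds; achronal C⁴ radial-graph tube of
clock-normalised marginally trapped spheres in the collar
slices, asymptotically not inside r₊, with jointly C³ pencil supersolutions ψ ∈ [m,1] at a level κᵢ
> 0, i.e. λ₀ ≥ κᵢ). In words: weak cosmic
censorship + typed exterior settling with closed Kerr labels |a| ≤ M + the card's order parameter:
the late tube exists, is faithful (K2) and liminf
κ_ql > 0 generically (K3, third-law injection read as dλ₀ > 0 under generic absorbed flux); nothing
is claimed about |aᵢ| < Mᵢ directly. [deps:
HorizonSubextremal] [difficulty: open-problem] (why it might fail: Contains WCC + typed exterior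
settling; late t*-slices may carry no MOTT asymptotic
to 𝓗⁺ or a jumping one (Williams2011), BH regions can lack trapped surfaces (arXiv:2308.13950),
extremal holes form on thresholds (KehleUnger2024
§1.6): codim 1 of {liminf κ_ql = 0} is a real third-law claim.) [Christodoulou1999, DafermosLuk2017,
Williams2011, AnderssonMetzger2009,
AnderssonMarsSimon2008, KehleUnger2024, arXiv:2308.13950, KlainermanSzeftel2023] #9 MGHDExists
(support) — every admissible datum has a maximal
globally hyperbolic vacuum development, stated over the repaired structure `VacuumCauchyDevelopment`
(Choquet-Bruhat–Geroch 1969 Thm. 3, Sbierski 2016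
Thm. 2.8); verbatim the item shared by the other routes of this summit; a prover closes it by
`choquetBruhat_geroch_exists_mghd_cauchy.forall_mem_admissibleVacuumData` once the named fact is
proved. [difficulty: XL] [ChoquetBruhatGeroch1969CMP,
Sbierski2016AHP, Ringstrom2009]

TWO-LAYER PLAN. Foreseen glued splits (k ≤ 3, depth 1), filed only after a crux closes or a census
asks. GenericRedShiftedSettling ⇐ GenericExcisedSettling
(censorship + C² settling only on the collar-EXCISED slabs {r₊ᵢ + δ ≤ rᵢ ≤ R}, |a| ≤ M, with
red-shifted collars — the part of the
card that removes the horizon from the generic problem entirely) → CollarSlaving (card K1+K2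
nonlinear, for ALL data: red-shifted collar +
excised C² convergence ⇒ C² convergence down to r₊, by the red-shift multiplier on the renormalised
Bianchi/null-structure system, defect L¹
via the area balance law) → GenericRedShiftedSettling; the typed signature of this split was drafted
this session (QuasiFinalStateDecomposition
… 2 ⊤ skeleton + excised slabs; folder gen_inline3.py) and exceeds the 4000-char item limit only by
the duplicated collar block, so it
waits for the definition request below. GenericExcisedSettling ⇐ LateTubeExists (card K2, ∀ data: an
eventually smooth achronal
outermost MOTT of the extended t*ᵢ-foliation, asymptotic to 𝓗⁺) → GenericTubeRedShifted (card K3: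
{liminf κ_ql = 0} has codimension ≥ 1)
→ settling. HorizonSubextremal ⇐ PencilUpperSemicontinuous (principal pencil eigenvalue is u.s.c.
under C² convergence of sections and
ambient metric) → ExtremalCollarMOTSUnique (a MOTS of a t*-slice of extremal Kerr inside {M ≤ r < M
+ η} is the horizon section) →
HorizonSubextremal. LinearRedShift ⇐ KillingCaseViaPencil (Killing horizon, κ_ql = κ: DR Thm 7.1
rephrased) → SphericalDynamical
(DafermosRodnianski2003 regime) → general. The spin cap (card P1: an outer-minimising trapped
surface of area A₀ > 8πM_ADM² forces
a_f²/M_f² ≤ 4x₀(1−x₀) < 1, x₀ = A₀/16πM_ADM²) is a support statement to be typed once event-horizon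
areas of the typed decomposition are
identifiable (card redshift-makes-the-horizon-knowable); not filed now.

KILL CRITERIA. KerrCalibration refuted (the clock-normalised pencil eigenvalue on Kerr–Schild
horizon sections is NOT κ(M,a), or not sign-equivalent
to sub-extremality) kills the dictionary: close `refuted:KerrCalibration` unless the refutation is a
pure normalisation factor (then it
is misstated: restate with the factor). LinearRedShift refuted by an explicit NEC collar (strongly
accreting Vaidya-type, or a shearing
vacuum MOTT) where collar energy grows without bulk supply ⇒ κ_ql is merely a diagnostic: the PDE
half of the card dies, U/T/G survive as
an order-parameter route (note it in the census; no pivot of the assembly needed).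
HorizonSubextremal refuted by a typed settling
development with a red-shifted collar tube but an extremal label ⇒ close outright
`refuted:HorizonSubextremal` unless the witness exploits a
missing faithfulness clause (then misstated: add the clause as a repaired item).
GenericRedShiftedSettling shares fate with every settling
route; its refutation by a generic no-late-MOTT phenomenon (Williams-type in vacuum) forces a pivot
to event-horizon surface gravity
(`CauchyDevelopment.HasEventuallyRedShiftedHorizon`, the vocabulary of TwoBoundarySqueeze).
TwoBoundarySqueeze.SubextremalUpgradeC2 ∧
GenericCensorshipThirdLaw proved elsewhere moots U and G but not K/T.

NOT DECOMPOSED YET. The multiplier construction itself (choice of N from (ψ, ℓ, k), the σ-large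
trick, the angular integration by parts that turns
spectral into usable positivity), the area-balance bound on the time-integrated defect, the spectral
theory of the pencil (existence,
simplicity, Donsker–Varadhan characterisation, continuity) over the prelude's `NullNormalPair` API,
the location of MOTS relative to 𝓗⁺
under complete 𝓘⁺, the compactness extraction of limit sections, and every constant (c₀ ~ κ, C₀ ~
e^{C(B)η}) — all layer-2 children or
`--supports` lemmas of provers.

CHEAPEST FALSIFIER. KerrCalibration in the Schwarzschild case by hand (done this session: ℓ = ∂_v, k
= −2∂_r on r = 2M gives θ_k = −4/r = −2/M and
δ_{−k}θ_ℓ = 2∂_r[(1−2M/r)/r]|_{2M} = 1/(2M²) = (1/4M)·(2/M) = κ·(−θ_k) ✓, so κ_ql = 1/4M =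
`Kerr.surfaceGravity M 0`); next cheapest: the
Kerr a ≠ 0 case symbolically (kit/sympy: axisymmetric pencil ODE on S² with Kerr–Schild horizon
data; expect eigenvalue √(M²−a²)/(r₊²+a²)
with eigenfunction ψ_J² and NO other positive supersolution level), then LinearRedShift numerically
on Vaidya m(v) = M − c/v and on a
strongly accreting episode (1+1 reduction): does the collar energy obey the slaving bound with
constants independent of the accretion
history?

NUMBERS. κ(M,a) = √(M²−a²)/(r₊²+a²) = (r₊−r₋)/(2(r₊²+a²)), r± = M ± √(M²−a²); κ(M,0) = 1/4M; κ ≤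
1/4M; √(1−(a/M)²)/4 ≤ Mκ ≤ √(1−(a/M)²)/2
(`Kerr.surfaceGravity`, KerrSurfaceGravity.lean; Wald1984GR (12.5.4)). Normalisations: prelude
`NullNormalPair` has g(L, L̲) = −2 (AMS);
Jaramillo uses ℓ·k = −1: pencil eigenvalue invariant, eigenfunction ψ_J² (Jaramillo2012 Lemma 1,
Def. 2). Under ℓ ↦ cℓ (constant c) κ_ql ↦
cκ_ql — the clock dt*(ℓ) = 1 pins it; without s-continuity of the deformed null normals the
supersolution level could be inflated by any
factor (checked this session; hence the C⁰-in-(s,n) clause on L_s in every item). Schwarzschild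
check: θ_k|_{r=2M} = −2/M, L(1) = 1/(2M²).
Item signature sizes: 3771 / 2983 / 2348 / 3611 / 326 chars (limit 4000). Items at open: 6 (4
cruxes, 1 support, 1 assembly). Cone (route-repair 2026-08-15): gate used-constants cone = 173
project constants, 0 unproved, `closes` OK (staffable); route-level imports cut 5 → 3 — dropped
Literature.Geometry.Lorentzian.QuasiFinalStateDecomposition and
Literature.Geometry.Lorentzian.IsometryProofs (0 constants of either occur in any item or in
`closes`; lean check of the re-rendered file rc 0, cone unchanged at 173), kept TrappedSurface
(NullNormalPair, IsMarginallyTrapped, nullExpansion, nullSecondFundamentalForm), KerrSurfaceGravity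
(Kerr.surfaceGravity) and KerrSchild; module closure 30 → 28 modules (the Statement's 24 +
TrappedSurface, Volume, KerrSurfaceGravity, KerrTimelikeSpan; the 4 extras declare 2 named facts,
riemannianVolume_lt_top_of_isCompact and riemannianMeasure_eq_integral_sqrt_det, both discharged in
VolumeProofs / VolumeChartFormula). The 3 census-`unproved` facts of the module cone are the
@[deprecated (since 2026-08-15)] refuted-as-stated tombstones of
Literature/Geometry/Lorentzian/Causality.lean —
LorentzianMetric.isGloballyHyperbolic_iff_exists_isCauchySurface,
LorentzianMetric.IsGloballyHyperbolic.isStronglyCausal,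
LorentzianMetric.IsGloballyHyperbolic.isClosed_causalFuture — reached only through the mandatory
import Summits.FinalStateConjecture.Statement → CauchyDevelopment / NullInfinity / KerrConvergence →
Causality and used by no item of this route: needs-fact NONE; their exit from the cone is prelude
hygiene already filed as work item defn-CausalityTombstones (route-repair of TwoBoundarySqueeze),
not route debt. When tenure files the foreseen GenericExcisedSettling / CollarSlaving children,
QuasiFinalStateDecomposition returns as an ITEM-level import (its closure adds 1 module declaring 0
named facts).
Route-repair 2026-08-16 (statement re-typed, p126844): HorizonSubextremal, LinearRedShift,
KerrCalibration, GenericRedShiftedSettling restated (tame genericity; RaysStayInClosure /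
honest-radii HasExhaustiveCharts / IsFutureOriented threaded through hypothesis and conclusion;
refuter repairs: jointly C³ pencil deformations, C⁴ collar charts, oriented ingoing normal in
LinearRedShift, KerrCalibration widened to |a| ≤ M); new signature sizes 3749 / 3125 / 2254 / 3736
chars; `closes` re-proved (tame codimension antitone in the exceptional set; lean check rc 0).
Crux-only `closes` rule (glue.non-crux-hypothesis): MGHDExists re-badged support → crux (rank 9;
logically needed anti-vacuity hypothesis; typing risk over the repaired prelude is its failure mode,
as in TwoBoundarySqueeze), KerrCalibration crux → support (intended content KNOWN once C³-restated:
Jaramillo2012 Lemma 1, Mars2012 Cor. 1–2, AMS2008 Lemma 4.1–4.2, extremal case included; retriage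
note 2026-08-15) and removed from the `closes` hypotheses; Assembly no longer a hypothesis. Cruxes
now: HorizonSubextremal (2), LinearRedShift (3), GenericRedShiftedSettling (5), MGHDExists (9).

DEFINITION REQUESTS. To be filed right after open (they unblock the foreseen CollarSlaving split and
shorten every item): (1) `LorentzianMetric.NullInwardPencilGe`
(topic Literature/Geometry/Lorentzian, next to TrappedSurface): for a map f : S → M with null normal
pair P, marginally trapped, and κ m : ℝ
— "there are ψ : S → [m,1] and a C² deformation F with F 0 = f, velocity −ψ·P.Lbar, null normal
pairs continuous in (s,y) with the given
L at s = 0, along which d/ds θ_{L_s}(y)|₀ ≥ κ(−θ_Lbar(y))ψ(y)" (the typed 'κ_ql ≥ κ' inlined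
verbatim in HorizonSubextremal / LinearRedShift
/ KerrCalibration / GenericRedShiftedSettling), with sanity lemmas: independence of the deformation
family on a MOTS (AMS Lemma 3.1),
monotone in κ, scaling under constant rescaling of L. (2) `Spacetime.RedShiftedCollar` (topic
Summits/FinalStateConjecture/FinalStateConjecture/Theorems,
a posited object of this problem): the collar predicate of HorizonSubextremal as a definition over
(𝓢, Λ, c, M, a, τ₀, chart). Cite facts
wanted later: AMS Lemma 4.1 (principal eigenvalue, Donsker–Varadhan formula) and Jaramillo2012 Lemma
1 as named facts.

Novelty: Searches (2026-08-15): grep of all 40 open FSC Theses for "stability operator|principal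
eigen|surface gravity|quasi-local|MOTS|red-shift"
(hits only: TwoBoundarySqueeze red-shift as black box, CriticalAncestry MOTS census,
PhaseMixingCapture κ-explicit near-extremal Kerr,
AnalyticInheritance κ formula — none defines κ quasi-locally or uses the MOTS stability operator);
`ledger negatives --problem
FinalStateConjecture` (0); `lit read arxiv:1206.1271` p.2 (Lemma 1, Def. 1–2) and `lit read
arxiv:0704.2889` pp.7–11 (Lemma 3.1/3.2, Def.
3.1, Lemma 4.1, Def./Prop. 5.1); `lit search --source zbmath "marginally outer trapped surface
stability surface gravity"` (8: Mars2012,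
Jaramillo2012, arXiv:1410.0509, arXiv:2311.02063, arXiv:2502.11581, … — kinematics/instability, no
PDE estimate, no final-state use);
`lit search --source zbmath "red-shift vector field wave equation black hole horizon decay"` (2:
DafermosRodnianski2005, Sbierski Gaussian
beams); `lit galaxy search "marginally outer trapped surfaces" --star pdf` (8; relevant: An
arXiv:1703.00118, Dotti arXiv:2308.13950);
`lit galaxy search "stability operator marginally outer trapped surface surface gravity red-shift"
--star all` (0); local searchd /
OpenAlex / S2 / arXiv remote unavailable this session (rc 75 / HTTP 429 / 0 rows) — recorded for the
grader.
Nearest prior art found: Jaramillo2012 (Lemma 1: δ_{ψ(−k_o)}θ^{(ℓ_o)} = −κθ^{(k_o)} on axisymmetric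
isolated horizons), BoothFairhurst2007
and Mars2012 (extremality ⇔ marginal  [refs: 1206.1271, 0704.2889, 1410.0509, 2311.02063, 2502.11581, 1703.00118, 2308.13950, 1509.08495, arxiv:1206.1271, arxiv:0704.2889, Mars2012, Jaramillo2012, DafermosRodnianski2005, BoothFairhurst2007, AnderssonMarsSimon2008, DafermosRodnianski2003]

Barriers (technique_class: red-shift-multiplier, MOTS-spectral-theory, quasi-local): - technique_class: red-shift-multiplier, MOTS-spectral-theory, quasi-local
- Literature.Barriers.FinalStateConjecture.AretakisInstability: embraced as the zero set — every
claim is under κ_ql ≥ κ > 0 and KerrCalibration makes κ_ql = 0 exactly the extremal family; the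
barrier's witness (a = M, conserved horizon charge, non-decay of transversal derivatives) is the
boundary of the route's domain and is what GenericRedShiftedSettling must show non-generic.
- Literature.Barriers.FinalStateConjecture.SlowlyRotatingKerrFrontier: orthogonal — no smallness in
a anywhere; the red-shift piece is the one ingredient already uniform in |a| < M, and U/K remove its
dependence on closeness to Kerr, not on a.
- Literature.Barriers.FinalStateConjecture.KerrSuperradiance: the multiplier is a non-Killing
timelike field supported in the collar; no conserved or positive Killing energy is used; the collar
lies inside the ergoregion for a ≠ 0 and LinearRedShift is stated with coordinate energies, not
T-energy.
- Literature.Barriers.FinalStateConjecture.SbierskiTrappingObstruction: the collar {|r − r₊| < η} is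
disjoint from the photon region for η small (sub-extremal); no integrated local energy decay at
trapping is claimed — the bulk enters LinearRedShift only as a sup of energies supplied from
outside.
- Literature.Barriers.FinalStateConjecture.KleinGordonSuperradiantInstability: it does not bite —
LinearRedShift claims SLAVING of the collar to the bulk, not decay; a persistent bulk mode feeds a
per

Novelty grade: new-combination — route-review grade (refuter-rreview-0815T16-4-0). Nearest prior art: the DICTIONARY T (clock-normalised pencil eigenvalue of Kerr horizon sections = kappa(M,a); kappa_ql = 0 <=> extremal) is KNOWN (Jaramillo 1206.1271 Lemma 1, Booth-Fairhurst 0708.2209, Mars 1205.1724); the red-shift multiplier is D (refuter refuter-rreview-0815T16-4-0, 2026-08-15T17:35:07Z; prior: arXiv:1206.1271 (Jaramillo 2012, Lemma 1: null-inward MOTS stability pencil = surface gravity on isolated horizons), arXiv:0708.2209 (Booth-Fairhurst 2008, extremality conditions for isolated and dynamical horizons), arXiv:1205.1724 (Mars 2012, stability of MOTS and symmetries; extremal <=> marginally stable), arXiv:0704.2889 (Andersson-Mars-Simon 2008, stability operator, principal eigenvalue Lem)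

History (route lifecycle, newest last):
- 2026-08-16T23:17:47Z · rev 4: restated HorizonSubextremal (stmt-FinalStateConjecture-11037), GenericRedShiftedSettling (stmt-FinalStateConjecture-11040), LinearRedShift (stmt-FinalStateConjecture-11038), KerrCalibration (stmt-FinalStateConjecture-11039) — route-repair (statement re-typed p126844): restate HorizonSubextremal + GenericRedShift (planner-rrepair-FinalStateConjecture-SpectralS-a1b1ad88-0)
- 2026-08-24T06:16:38Z · DORMANT — reconciler: no traction for 6.6 d (last activity item-evidence-added at 2026-08-17T15:45:33Z); parked, not closed — `ledger route dormant route-FinalStateConjec (operator:999:3636172)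
- 2026-08-30T17:12:34Z · REACTIVATED (open) — reconciler: reactivated — activity statement-checked at 2026-08-30T15:54:01Z after parking at 2026-08-24T06:16:38Z (operator:999:625248)
- 2026-09-04T18:00:19Z · DORMANT — reconciler: no traction for 5 d (last activity statement-checked at 2026-08-30T17:26:59Z); parked, not closed — `ledger route dormant route-FinalStateConjecture (operator:999:1787813)

sub-problem: FinalStateConjecture · status: dormant · opened planner-plancard-FinalStateConjecture-FinalSt-55db9415-0 2026-08-15T16:40:37Z · rev 11 · ledger route-FinalStateConjecture-SpectralSurfaceGravity
GENERATED by the gate from the ledger (D-0016/17). Provers cite these decls: `theorem foo : Summit.FinalStateConjecture.FinalStateConjecture.Theses.SpectralSurfaceGravity.<Decl> := …` in Summits/FinalStateConjecture/FinalStateConjecture/Theorems/<Name>.lean.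
-/

namespace Summit.FinalStateConjecture.FinalStateConjecture.Theses.SpectralSurfaceGravity

open scoped BigOperators Topology Manifold Classical MeasureTheory ProbabilityTheory Matrix InnerProductSpace ComplexConjugate ContinuousMap
open Filter Set Function TopologicalSpace MeasureTheory

attribute [summit_statement] _root_.FinalStateConjecture

-- earlier HorizonSubextremal (stmt-FinalStateConjecture-11037, replaced 2026-08-16T23:17:47Z -> stmt-FinalStateConjecture-17367): retired by None — let E4 := EuclideanSpace ℝ (Fin 4); let E3 := EuclideanSpace ℝ (Fin 3); let S2 := Metric.sphere (0 : E3) 1; let RSC := fun (𝓢 : Literature.Geometry.Lorentzian.Spacetime.{0} 4) (Λ : Literature.Geometry.Lorentzian.lorentzGroup) (c : E4) (M a τ₀ : ℝ) (chart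
/-- item stmt-FinalStateConjecture-17367 · crux · rank 2 · open · by planner
why it might fail: Even with honest (jointly C³) supersolutions λ₀ ≥ κ > 0, a red-shifted MOTS tube of an asymptotically extremal hole may sit strictly inside 𝓗⁺ where geometry is only C³-bounded; needs usc of λ₀ under C² limits of sections and MOTS uniqueness near r = M in extremal Kerr slices (KehleUnger2024).
sources: KehleUnger2024, AnderssonMarsSimon2008, Jaramillo2012, Mars2012, AnderssonMetzger2009, Aretakis2015
[crux] (card consequence (ii), deciding form) For every connected Hausdorff second-countable
3-manifold X, every admissible vacuum datum D and every MGHD 𝒟 of D: suppose some region O carries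
an N-black-hole `FinalStateDecomposition d` in C² (boosted Kerr near zones, 0 < Mᵢ, |aᵢ| ≤ Mᵢ, flat
radiation zone, separation, covering) with O = J⁺(ιX) ∩ I⁻(d.charted), rays staying in closure O,
exhaustive charts with honest radii and future-oriented chart times (`RaysStayInClosure`,
`HasExhaustiveCharts`, `IsFutureOriented`: the re-typed Statement's clauses, p126844), and suppose
every hole i has a RED-SHIFTED COLLAR — an extension Φ of the rest-frame Kerr–Schild chart to the
collar {t* > τ₀, |r − r₊(Mᵢ,aᵢ)| < η} (C⁴ open embedding; on {t* ≥ τ₁} the pulled-back metric is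
honestly C³-bounded by B, its t*-slices are uniformly spacelike (≥ b|v|²) and it admits a unit
vector with g ≤ −b) and a radial-graph tube of spheres n ↦ Φ(τ, ρ(τ,n)·n) in the collar slices (ρ
C⁴-bounded by B), achronal, eventually above r₊ − ε in Kerr–Schild radius for every ε > 0, whose
sections are marginally trapped (θ_ℓ = 0, θ_k < 0) for a null pair with dt*(ℓ) = 1, g(ℓ,k) = −2 and
admit ψ ∈ [m,1] and a jointly C³ def -/
@[route_item "route-FinalStateConjecture-SpectralSurfaceGravity"]
def HorizonSubextremal : Prop :=
  let E4 := EuclideanSpace ℝ (Fin 4); let E3 := EuclideanSpace ℝ (Fin 3); let S2 := Metric.sphere (0 : E3) 1; let RSC := fun (𝓢 : Literature.Geometry.Lorentzian.Spacetime.{0} 4) (Λ : Literature.Geometry.Lorentzian.lorentzGroup) (c : E4) (M a τ₀ : ℝ) (chart : Literature.Geometry.Lorentzian.boostedKerrExterior Λ c M a → 𝓢.carrier) => ∃ (η κ m b B τ₁ : ℝ) (Φ : E4 → 𝓢.carrier) (ρ : ℝ → E3 → ℝ), 0 < η ∧ 0 < κ ∧ 0 < m ∧ 0 < b ∧ let r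 := Literature.Geometry.Lorentzian.Kerr.radius a; let C : Set E4 := {z | τ₀ < z 0 ∧ |r z - Literature.Geometry.Lorentzian.Kerr.rPlus M a| < η}; let gC : E4 → E4 →L[ℝ] E4 →L[ℝ] ℝ := fun z ↦ Literature.Geometry.Lorentzian.pullbackBilin (I := 𝓡 4) (I' := 𝓘(ℝ, E4)) Φ 𝓢.metric.val z; let sec : ℝ → S2 → E4 := fun τ n ↦ Literature.Geometry.Lorentzian.E4.ofTimeSpace τ (ρ τ n • (n : E3)); let A := Ioi τ₁ ×ˢ {y : E3 | 2⁻¹ < ‖y‖ ∧ ‖y‖ < 2}; let T := (fun q : ℝ × S2 ↦ Φ (sec q.1 q.2)) '' (Ioi τ₁ ×ˢ univ); ContMDiffOn 𝓘(ℝ, E4) (𝓡 4) 4 Φ C ∧ Topology.IsOpenEmbedding (C.restrict Φ) ∧ EqOn chart (Φ ∘ Literature.Geometry.Lorentzian.poincareInv Λ c ∘ Subtype.val) {x | Literature.Geometry.Lorentzian.poincareInv Λ c x ∈ C} ∧ Literature.Geometry.Lorentzian.supCkENorm {z ∈ C | τ₁ ≤ z 0} 3 gC ≤ ENNReal.ofReal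 B ∧ (∀ z ∈ C, τ₁ ≤ z 0 → (∀ v : E4, v 0 = 0 → b * ‖v‖ ^ 2 ≤ gC z v v) ∧ ∃ w : E4, ‖w‖ ≤ 1 ∧ gC z w w ≤ -b) ∧ ContDiffOn ℝ 4 (uncurry ρ) A ∧ Literature.Geometry.Lorentzian.supCkENorm A 4 (uncurry ρ) ≤ ENNReal.ofReal B ∧ (∀ τ, τ₁ < τ → ∀ n : S2, sec τ n ∈ C) ∧ (∀ ε > (0 : ℝ), ∃ τ₂ : ℝ, ∀ τ, τ₂ < τ → ∀ n : S2, Literature.Geometry.Lorentzian.Kerr.rPlus M a - ε < r (sec τ n)) ∧ (∀ p ∈ T, ∀ q ∈ T, q ∉ 𝓢.metric.chronologicalFuture 𝓢.timeOrientation {p}) ∧ (∀ τ, τ₁ < τ → ∀ [𝓢.metric.HasLeviCivita], ∀ hpb, ∃ (ψ : S2 → ℝ) (F : ℝ → S2 → 𝓢.carrier) (P : ∀ s, Literature.Geometry.Lorentzian.LorentzianMetric.NullNormalPair (𝓡 2) 𝓢.metric 𝓢.timeOrientation (F s)) (hF : ∀ s, 𝓢.metric.IsSpacelikeImmersion (𝓡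 2) (F s)), (F 0 = fun n ↦ Φ (sec τ n)) ∧ ContMDiff (𝓘(ℝ, ℝ).prod (𝓡 2)) (𝓡 4) 3 (uncurry F) ∧ ContMDiff (𝓘(ℝ, ℝ).prod (𝓡 2)) (𝓡 4).tangent 0 (fun p : ℝ × S2 ↦ (Bundle.TotalSpace.mk' E4 (F p.1 p.2) ((P p.1).L p.2) : TangentBundle (𝓡 4) 𝓢.carrier)) ∧ 𝓢.metric.IsMarginallyTrapped hpb (hF 0) (P 0) ∧ (∀ n, m ≤ ψ n ∧ ψ n ≤ 1) ∧ (∀ n, ∃ v : E4, v 0 = 1 ∧ mfderiv 𝓘(ℝ, E4) (𝓡 4) Φ (sec τ n) v = (P 0).L n) ∧ (∀ n, mfderiv 𝓘(ℝ, ℝ) (𝓡 4) (fun s ↦ F s n) 0 1 = (-(ψ n)) • (P 0).Lbar n) ∧ (∀ n, ∃ D : ℝ, HasDerivAt (fun s ↦ 𝓢.metric.nullExpansion (F s) hpb (hF s) (P s).L n) D 0 ∧ κ * (-(𝓢.metric.nullExpansion (F 0) hpb (hF 0) (P 0).Lbar n)) * ψ n ≤ D)); ∀ (X : Type) [TopologicalSpace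 X] [ChartedSpace E3 X] [IsManifold (𝓡 3) ((⊤ : ℕ∞) : WithTop ℕ∞) X] [T2Space X] [SecondCountableTopology X] [ConnectedSpace X], ∀ D ∈ Literature.Geometry.Lorentzian.admissibleVacuumData X, ∀ 𝒟 : Literature.Geometry.Lorentzian.VacuumCauchyDevelopment D, 𝒟.IsMaximal → (∃ (O : Set 𝒟.carrier) (d : Literature.Geometry.Lorentzian.FinalStateDecomposition 𝒟.toSpacetime O 2), O = Summit.FinalStateConjecture.exteriorOf 𝒟.toCauchyDevelopment d.charted ∧ Summit.FinalStateConjecture.RaysStayInClosure 𝒟.toCauchyDevelopment O ∧ Summit.FinalStateConjecture.HasExhaustiveCharts d ∧ Summit.FinalStateConjecture.IsFutureOriented d ∧ ∀ i, RSC 𝒟.toSpacetime (d.motion i).1 (d.motion i).2 (d.mass i) (d.spin i) d.τ₀ (d.chart i)) → ∃ (O : Set 𝒟.carrier) (d : Literature.Geometry.Lorentzian.FinalStateDecomposition 𝒟.toSpacetime O 2), (∀ i, Literature.Geometry.Lorentzian.Kerr.IsSubextremal (d.mass i) (d.spin i)) ∧ O = Summit.FinalStateConjecture.exteriorOf 𝒟.toCauchyDevelopment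 d.charted ∧ Summit.FinalStateConjecture.RaysStayInClosure 𝒟.toCauchyDevelopment O ∧ Summit.FinalStateConjecture.HasExhaustiveCharts d ∧ Summit.FinalStateConjecture.IsFutureOriented d

-- earlier LinearRedShift (stmt-FinalStateConjecture-11038, replaced 2026-08-16T23:17:47Z -> stmt-FinalStateConjecture-17369): retired by None — let E4 := EuclideanSpace ℝ (Fin 4); let E3 := EuclideanSpace ℝ (Fin 3); let S2 := Metric.sphere (0 : E3) 1; ∀ (r₀ η κ m b B : ℝ), 0 < η → η < r₀ → 0 < κ → 0 < m → 0 < b → ∃ (η' C₀ c₀ : ℝ), 0 < η' ∧ η' < η ∧ 0 < c₀ ∧ ∀ (𝓢 : Literature.Geometry.Lorentzian.Spac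
/-- item stmt-FinalStateConjecture-17369 · crux · rank 3 · open · by planner
why it might fail: Oriented and with honest λ₀ ≥ κ, still open: DR's K^N ≥ bJ^N uses the pointwise inaffinity of a shear-free Killing generator; a shearing non-spherical dynamical MOTT, large osc(ψ) or transient θ_k may defeat coercivity of every ψ-weighted current with constants uniform in (κ, m, b, B).
sources: DafermosRodnianski2008, DafermosRodnianski2005, DafermosRodnianski2003, arXiv:1509.08495, Aretakis2011ERN1, AnderssonMarsSimon2008
[crux] (card K1 for □_g, the mechanism's PDE test) For all constants (r₀, η, κ, m, b, B) there are
η′ ∈ (0, η), C₀ and c₀ > 0 such that: for EVERY time-oriented spacetime (M, g), every collar chart Φ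
of {x⁰ > τ₁ − 1, |‖x‖ − r₀| < η} (C⁴ open embedding, Φ^*g honestly C³-bounded by B, slices {x⁰ = c}
uniformly spacelike ≥ b|v|², a unit vector with g ≤ −b, null energy condition on the image), every
radial-graph tube ρ (C⁴-bounded by B, |ρ − r₀| < η/2) which is achronal and whose sections are
marginally trapped for the clock-normalised pair (dx⁰(ℓ) = 1, g(ℓ,k) = −2) which is ORIENTED — the
chart preimage of the ingoing normal k points to decreasing |y| (refuter repair 2026-08-15: the
unoriented statement is killed by the radially inverted Schwarzschild collar chart) — with a pencil
supersolution ψ ∈ [m,1] realised by a jointly C³ deformation (ψ ∈ C², classical first variation),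
δ_{ψ(−k)}θ^{(ℓ)} ≥ κ(−θ^{(k)})ψ, and every C² solution of □_g φ = 0 on the collar: for τ₁ ≤ σ ≤ τ₂
the coordinate energy ∫|∂(φ∘Φ)|² on the inner shell {ρ < |y| < ρ + η′} at time τ₂ is ≤
C₀e^{−c₀(τ₂−σ)}·(energy on {ρ < |y| < r₀+η} at σ) + C₀·sup_{[σ,τ₂]}(energy on {ρ+η′ ≤ |y| < r₀+η}) —
exponential forgetting of -/
@[route_item "route-FinalStateConjecture-SpectralSurfaceGravity"]
def LinearRedShift : Prop :=
  let E4 := EuclideanSpace ℝ (Fin 4); let E3 := EuclideanSpace ℝ (Fin 3); let S2 := Metric.sphere (0 : E3) 1; ∀ (r₀ η κ m b B : ℝ), 0 < η → η < r₀ → 0 < κ → 0 < m → 0 < b → ∃ (η' C₀ c₀ : ℝ), 0 < η' ∧ η' < η ∧ 0 < c₀ ∧ ∀ (𝓢 : Literature.Geometry.Lorentzian.Spacetime.{0} 4) (τ₁ : ℝ) (Φ : E4 → 𝓢.carrier) (ρ : ℝ → E3 → ℝ), ∀ [𝓢.metric.HasLeviCivita], let C : Set E4 := {x | τ₁ - 1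 < x 0 ∧ |‖Literature.Geometry.Lorentzian.E4.spatial x‖ - r₀| < η}; let gC : E4 → E4 →L[ℝ] E4 →L[ℝ] ℝ := fun x ↦ Literature.Geometry.Lorentzian.pullbackBilin (I := 𝓡 4) (I' := 𝓘(ℝ, E4)) Φ 𝓢.metric.val x; let sec : ℝ → S2 → E4 := fun τ n ↦ Literature.Geometry.Lorentzian.E4.ofTimeSpace τ (ρ τ n • (n : E3)); let A := Ioi (τ₁ - 1) ×ˢ {y : E3 | 2⁻¹ < ‖y‖ ∧ ‖y‖ < 2}; let T := (fun q : ℝ × S2 ↦ Φ (sec q.1 q.2)) '' (Ioi (τ₁ - 1) ×ˢ univ); (ContMDiffOn 𝓘(ℝ, E4) (𝓡 4) 4 Φ C ∧ Topology.IsOpenEmbedding (C.restrict Φ) ∧ Literature.Geometry.Lorentzian.supCkENorm C 3 gC ≤ ENNReal.ofReal B ∧ (∀ x ∈ C, (∀ v : E4, v 0 = 0 → b * ‖v‖ ^ 2 ≤ gC x v v) ∧ ∃ w : E4, ‖w‖ ≤ 1 ∧ gC x w w ≤ -b) ∧ (∀ p ∈ Φ '' C, ∀ v : TangentSpace (𝓡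 4) p, 𝓢.metric.val p v v = 0 → 0 ≤ 𝓢.metric.toPseudoRiemannianMetric.ricci p v v) ∧ ContDiffOn ℝ 4 (uncurry ρ) A ∧ Literature.Geometry.Lorentzian.supCkENorm A 4 (uncurry ρ) ≤ ENNReal.ofReal B ∧ (∀ τ, τ₁ - 1 < τ → ∀ n : S2, |ρ τ n - r₀| < η / 2) ∧ (∀ p ∈ T, ∀ q ∈ T, q ∉ 𝓢.metric.chronologicalFuture 𝓢.timeOrientation {p}) ∧ (∀ τ, τ₁ - 1 < τ → ∀ hpb, ∃ (ψ : S2 → ℝ) (F : ℝ → S2 → 𝓢.carrier) (P : ∀ s, Literature.Geometry.Lorentzian.LorentzianMetric.NullNormalPair (𝓡 2) 𝓢.metric 𝓢.timeOrientation (F s)) (hF : ∀ s, 𝓢.metric.IsSpacelikeImmersion (𝓡 2) (F s)), (F 0 = fun n ↦ Φ (sec τ n)) ∧ ContMDiff (𝓘(ℝ, ℝ).prod (𝓡 2)) (𝓡 4) 3 (uncurry F) ∧ ContMDiff (𝓘(ℝ, ℝ).prod (𝓡 2)) (𝓡 4).tangent 0 (fun p : ℝ × S2 ↦ (Bundle.TotalSpace.mk'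 E4 (F p.1 p.2) ((P p.1).L p.2) : TangentBundle (𝓡 4) 𝓢.carrier)) ∧ 𝓢.metric.IsMarginallyTrapped hpb (hF 0) (P 0) ∧ (∀ n, m ≤ ψ n ∧ ψ n ≤ 1) ∧ (∀ n, ∃ v : E4, v 0 = 1 ∧ mfderiv 𝓘(ℝ, E4) (𝓡 4) Φ (sec τ n) v = (P 0).L n) ∧ (∀ n, ∃ u : E4, mfderiv 𝓘(ℝ, E4) (𝓡 4) Φ (sec τ n) u = (P 0).Lbar n ∧ inner ℝ (Literature.Geometry.Lorentzian.E4.spatial u) ((n : E3)) < 0) ∧ (∀ n, mfderiv 𝓘(ℝ, ℝ) (𝓡 4) (fun s ↦ F s n) 0 1 = (-(ψ n)) • (P 0).Lbar n) ∧ (∀ n, ∃ D : ℝ, HasDerivAt (fun s ↦ 𝓢.metric.nullExpansion (F s) hpb (hF s) (P s).L n) D 0 ∧ κ * (-(𝓢.metric.nullExpansion (F 0) hpb (hF 0) (P 0).Lbar n)) * ψ n ≤ D))) → ∀ (φ : 𝓢.carrier → ℝ), ContMDiff (𝓡 4) 𝓘(ℝ, ℝ) 2 φ → (∀ p ∈ Φ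 '' C, 𝓢.metric.toPseudoRiemannianMetric.dalembertian φ p = 0) → ∀ σ τ₂ : ℝ, τ₁ ≤ σ → σ ≤ τ₂ → (∫⁻ y in {y : E3 | y ≠ 0 ∧ ρ τ₂ (‖y‖⁻¹ • y) < ‖y‖ ∧ ‖y‖ < ρ τ₂ (‖y‖⁻¹ • y) + η'}, ‖fderiv ℝ (φ ∘ Φ) (Literature.Geometry.Lorentzian.E4.ofTimeSpace τ₂ y)‖ₑ ^ 2) ≤ ENNReal.ofReal (C₀ * Real.exp (-(c₀ * (τ₂ - σ)))) * (∫⁻ y in {y : E3 | y ≠ 0 ∧ ρ σ (‖y‖⁻¹ • y) < ‖y‖ ∧ ‖y‖ < r₀ + η}, ‖fderiv ℝ (φ ∘ Φ) (Literature.Geometry.Lorentzian.E4.ofTimeSpace σ y)‖ₑ ^ 2) + ENNReal.ofReal C₀ * ⨆ τ ∈ Icc σ τ₂, (∫⁻ y in {y : E3 | y ≠ 0 ∧ ρ τ (‖y‖⁻¹ • y) + η' ≤ ‖y‖ ∧ ‖y‖ < r₀ + η}, ‖fderiv ℝ (φ ∘ Φ) (Literature.Geometry.Lorentzian.E4.ofTimeSpace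 τ y)‖ₑ ^ 2)

-- earlier GenericRedShiftedSettling (stmt-FinalStateConjecture-11040, replaced 2026-08-16T23:17:47Z -> stmt-FinalStateConjecture-17368): retired by None — let E4 := EuclideanSpace ℝ (Fin 4); let E3 := EuclideanSpace ℝ (Fin 3); let S2 := Metric.sphere (0 : E3) 1; let RSC := fun (𝓢 : Literature.Geometry.Lorentzian.Spacetime.{0} 4) (Λ : Literature.Geometry.Lorentzian.lorentzGroup) (c : E4) (M a τ₀ : ℝ)
/-- item stmt-FinalStateConjecture-17368 · crux · rank 5 · open · by planner
why it might fail: Contains WCC + typed exterior settling, now for TAME generic families (one fixed end, wDist-continuous, immersed); late t*-slices may carry no MOTT asymptotic to 𝓗⁺ (Williams2011), BH regions can lack trapped surfaces (arXiv:2308.13950), extremal holes form on thresholds (KehleUnger2024).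
sources: Christodoulou1999, DafermosLuk2017, Williams2011, AnderssonMetzger2009, AnderssonMarsSimon2008, KehleUnger2024
[crux] (card K2+K3 + the settling/censorship front end; ONE generic statement because Christodoulou
genericity is not closed under ∧) For every X, TAME-Christodoulou-generically in the admissible
class (`IsTameChristodoulouGeneric … 1`, re-typed Statement p126844: the exceptional set is avoided
by an injective one-parameter family of admissible data on ONE fixed asymptotically flat end,
jointly smooth, wDist-continuous and immersed at c = 0): every MGHD has complete 𝓘⁺ (sojourn form)
AND some region O carries an exhaustive C² `FinalStateDecomposition` (finitely many boosted Kerrs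
with |aᵢ| ≤ Mᵢ plus radiation, O = J⁺(ιX) ∩ I⁻(charted), every future-complete normalised null ray
from the data in closure O, honest growing near-zone radii, future-oriented chart times —
`RaysStayInClosure`, `HasExhaustiveCharts`, `IsFutureOriented` as in the Statement) every hole of
which has a red-shifted collar in the sense of HorizonSubextremal (C⁴ extended Kerr–Schild collar
chart with eventual uniform C³ metric bounds; achronal C⁴ radial-graph tube of clock-normalised
marginally trapped spheres in the collar slices, asymptotically not inside r₊, with jointly C³
pencil supersolutions ψ ∈ [m,1] at a -/
@[route_item "route-FinalStateConjecture-SpectralSurfaceGravity"]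
def GenericRedShiftedSettling : Prop :=
  let E4 := EuclideanSpace ℝ (Fin 4); let E3 := EuclideanSpace ℝ (Fin 3); let S2 := Metric.sphere (0 : E3) 1; let RSC := fun (𝓢 : Literature.Geometry.Lorentzian.Spacetime.{0} 4) (Λ : Literature.Geometry.Lorentzian.lorentzGroup) (c : E4) (M a τ₀ : ℝ) (chart : Literature.Geometry.Lorentzian.boostedKerrExterior Λ c M a → 𝓢.carrier) => ∃ (η κ m b B τ₁ : ℝ) (Φ : E4 → 𝓢.carrier) (ρ : ℝ → E3 → ℝ), 0 < η ∧ 0 < κ ∧ 0 < m ∧ 0 < b ∧ let r := Literature.Geometry.Lorentzian.Kerr.radius a; let C : Set E4 := {z | τ₀ < z 0 ∧ |r z - Literature.Geometry.Lorentzian.Kerr.rPlus M a| < η}; let gC : E4 → E4 →L[ℝ] E4 →L[ℝ] ℝ := fun z ↦ Literature.Geometry.Lorentzian.pullbackBilin (I := 𝓡 4) (I' := 𝓘(ℝ, E4)) Φ 𝓢.metric.val z; let sec : ℝ → S2 → E4 := fun τ n ↦ Literature.Geometry.Lorentzian.E4.ofTimeSpace τ (ρ τ n • (n : E3)); let A :=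 Ioi τ₁ ×ˢ {y : E3 | 2⁻¹ < ‖y‖ ∧ ‖y‖ < 2}; let T := (fun q : ℝ × S2 ↦ Φ (sec q.1 q.2)) '' (Ioi τ₁ ×ˢ univ); ContMDiffOn 𝓘(ℝ, E4) (𝓡 4) 4 Φ C ∧ Topology.IsOpenEmbedding (C.restrict Φ) ∧ EqOn chart (Φ ∘ Literature.Geometry.Lorentzian.poincareInv Λ c ∘ Subtype.val) {x | Literature.Geometry.Lorentzian.poincareInv Λ c x ∈ C} ∧ Literature.Geometry.Lorentzian.supCkENorm {z ∈ C | τ₁ ≤ z 0} 3 gC ≤ ENNReal.ofReal B ∧ (∀ z ∈ C, τ₁ ≤ z 0 → (∀ v : E4, v 0 = 0 → b * ‖v‖ ^ 2 ≤ gC z v v) ∧ ∃ w : E4, ‖w‖ ≤ 1 ∧ gC z w w ≤ -b) ∧ ContDiffOn ℝ 4 (uncurry ρ) A ∧ Literature.Geometry.Lorentzian.supCkENorm A 4 (uncurry ρ) ≤ ENNReal.ofReal B ∧ (∀ τ, τ₁ < τ → ∀ n : S2, sec τ n ∈ C) ∧ (∀ ε > (0 : ℝ), ∃ τ₂ : ℝ,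 ∀ τ, τ₂ < τ → ∀ n : S2, Literature.Geometry.Lorentzian.Kerr.rPlus M a - ε < r (sec τ n)) ∧ (∀ p ∈ T, ∀ q ∈ T, q ∉ 𝓢.metric.chronologicalFuture 𝓢.timeOrientation {p}) ∧ (∀ τ, τ₁ < τ → ∀ [𝓢.metric.HasLeviCivita], ∀ hpb, ∃ (ψ : S2 → ℝ) (F : ℝ → S2 → 𝓢.carrier) (P : ∀ s, Literature.Geometry.Lorentzian.LorentzianMetric.NullNormalPair (𝓡 2) 𝓢.metric 𝓢.timeOrientation (F s)) (hF : ∀ s, 𝓢.metric.IsSpacelikeImmersion (𝓡 2) (F s)), (F 0 = fun n ↦ Φ (sec τ n)) ∧ ContMDiff (𝓘(ℝ, ℝ).prod (𝓡 2)) (𝓡 4) 3 (uncurry F) ∧ ContMDiff (𝓘(ℝ, ℝ).prod (𝓡 2)) (𝓡 4).tangent 0 (fun p : ℝ × S2 ↦ (Bundle.TotalSpace.mk' E4 (F p.1 p.2) ((P p.1).L p.2) : TangentBundle (𝓡 4) 𝓢.carrier)) ∧ 𝓢.metric.IsMarginallyTrapped hpb (hF 0) (P 0) ∧ (∀ n,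 m ≤ ψ n ∧ ψ n ≤ 1) ∧ (∀ n, ∃ v : E4, v 0 = 1 ∧ mfderiv 𝓘(ℝ, E4) (𝓡 4) Φ (sec τ n) v = (P 0).L n) ∧ (∀ n, mfderiv 𝓘(ℝ, ℝ) (𝓡 4) (fun s ↦ F s n) 0 1 = (-(ψ n)) • (P 0).Lbar n) ∧ (∀ n, ∃ D : ℝ, HasDerivAt (fun s ↦ 𝓢.metric.nullExpansion (F s) hpb (hF s) (P s).L n) D 0 ∧ κ * (-(𝓢.metric.nullExpansion (F 0) hpb (hF 0) (P 0).Lbar n)) * ψ n ≤ D)); let RS := fun (X : Type) [TopologicalSpace X] [ChartedSpace E3 X] [IsManifold (𝓡 3) ((⊤ : ℕ∞) : WithTop ℕ∞) X] [ConnectedSpace X] (D : Literature.Geometry.Lorentzian.InitialDataSet (𝓡 3) X) (𝒟 : Literature.Geometry.Lorentzian.VacuumCauchyDevelopment D) => ∃ (O : Set 𝒟.carrier) (d : Literature.Geometry.Lorentzian.FinalStateDecomposition 𝒟.toSpacetime O 2), O = Summit.FinalStateConjecture.exteriorOf 𝒟.toCauchyDevelopment d.charted ∧ Summit.FinalStateConjecture.RaysStayInClosure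 𝒟.toCauchyDevelopment O ∧ Summit.FinalStateConjecture.HasExhaustiveCharts d ∧ Summit.FinalStateConjecture.IsFutureOriented d ∧ ∀ i, RSC 𝒟.toSpacetime (d.motion i).1 (d.motion i).2 (d.mass i) (d.spin i) d.τ₀ (d.chart i); ∀ (X : Type) [TopologicalSpace X] [ChartedSpace E3 X] [IsManifold (𝓡 3) ((⊤ : ℕ∞) : WithTop ℕ∞) X] [T2Space X] [SecondCountableTopology X] [ConnectedSpace X], Literature.Geometry.Lorentzian.InitialDataSet.IsTameChristodoulouGeneric (Literature.Geometry.Lorentzian.admissibleVacuumData X) (fun D ↦ ∀ 𝒟 : Literature.Geometry.Lorentzian.VacuumCauchyDevelopment D, 𝒟.IsMaximal → Summit.FinalStateConjecture.HasCompleteNullInfinity 𝒟.toCauchyDevelopment ∧ RS X D 𝒟) 1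

/-- item stmt-FinalStateConjecture-18349 · crux · rank 6 · open · by planner
why it might fail: Contains tame-generic weak cosmic censorship; the collar rider needs generically a late MOTT in the extended t*-slicing asymptotic to 𝓗⁺ with uniform C³ bounds across it and liminf κ_ql > 0 — jumping/absent MOTTs (Williams2011, arXiv:2308.13950), extremal thresholds (KehleUnger2024).
sources: Christodoulou1999, DafermosLuk2017, AnderssonMarsSimon2008, AnderssonMetzger2009, Williams2011, KehleUnger2024
[crux] GENERIC CORE (censorship + quasi-local third law; asserts NO settling). For every X,
tame-Christodoulou-generically in the admissible class: every MGHD has complete 𝓘⁺ (sojourn form)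
AND, IF its exterior settles in C²_loc at all (some (O, q): quasi-⊤ chart geometry — finitely many
boosted Kerr exteriors |aᵢ| ≤ Mᵢ + flat zone — whose hole charts converge to Kerr in C² on every
shell {r₊ᵢ+δ ≤ rᵢ ≤ R}, δ > 0, with O = J⁺(ιX) ∩ I⁻(charted), rays in closure O, excised-exhaustive
honest charts, future orientation: `CauchyDevelopment.IsLocSettling`), THEN it settles in C²_loc
with hole charts that carry RED-SHIFTED COLLARS (`Spacetime.RedShiftedCollarC4`: C⁴ extension across
r = r₊ with eventually uniform C³ metric bounds reproducing the chart; achronal C⁴ tube of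
clock-normalised marginally trapped spheres, asymptotically not inside r₊, with jointly C³ pencil
supersolutions ψ ∈ [m,1] at a level κ > 0). The ∃→∃ form is forced: '∀ q, collars' is refutable by
re-parametrising hole charts near r₊. A CONSEQUENCE of G (G → this by the forgetful map
`isLocSettling_toQuasi`); with CensoredLocSettling and CollarCompactness it gives G back
(genericRedShiftedSettling_of_subs). Nearest siblin -/
@[route_item "route-FinalStateConjecture-SpectralSurfaceGravity"]
def GenericCensoredCollars : Prop :=
  ∀ (X : Type) [TopologicalSpace X] [ChartedSpace Literature.Geometry.Lorentzian.E3 X] [IsManifold (𝓡 3) ((⊤ : ℕ∞) : WithTop ℕ∞) X] [T2Space X] [SecondCountableTopology X] [ConnectedSpace X], Literature.Geometry.Lorentzian.InitialDataSet.IsTameChristodoulouGeneric (Literature.Geometry.Lorentzian.admissibleVacuumData X) (fun D ↦ ∀ 𝒟 : Literature.Geometry.Lorentzian.VacuumCauchyDevelopment D, 𝒟.IsMaximal → Summit.FinalStateConjecture.HasCompleteNullInfinity 𝒟.toCauchyDevelopment ∧ ((∃ (O : Set 𝒟.carrier) (q : Literature.Geometry.Lorentzian.QuasiFinalStateDecomposition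 𝒟.toSpacetime O 2 ⊤), 𝒟.toCauchyDevelopment.IsLocSettling O q) → ∃ (O : Set 𝒟.carrier) (q : Literature.Geometry.Lorentzian.QuasiFinalStateDecomposition 𝒟.toSpacetime O 2 ⊤), 𝒟.toCauchyDevelopment.IsLocSettling O q ∧ ∀ i, 𝒟.toSpacetime.RedShiftedCollarC4 (q.motion i).1 (q.motion i).2 (q.mass i) (q.spin i) q.τ₀ (q.chart i))) 1

/-- item stmt-FinalStateConjecture-18351 · crux · rank 7 · open · by planner
why it might fail: Asserted for ALL censored data: one non-generic complete-𝓘⁺ development that never settles (eternal non-Kerr asymptotically stationary end-state, bound non-merging cluster, stationary multi-hole equilibrium — excluded only in axisymmetry) refutes it; near Kerr only |a| ≪ M is known.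
sources: DafermosLuk2017, KlainermanSzeftel2023, Hintz2026, arXiv:2104.08222, Christodoulou1999, doi:10.1007/s10714-009-0840-8
[crux] THE CENSORED FINAL-STATE THEOREM, ALL DATA, HORIZON-EXCISED. For every X, every admissible
datum D, every MGHD 𝒟 of D WITH COMPLETE 𝓘⁺: some region O carries a C²_loc settling (O, q) — q :
QuasiFinalStateDecomposition 𝒟 O 2 ⊤ (N boosted Kerr exteriors with |aᵢ| ≤ Mᵢ, late charts,
separation, sublinear excision, flat chart, covering) whose hole charts converge to boosted Kerr in
C² on every shell {t*ᵢ = τ, r₊ᵢ+δ ≤ rᵢ ≤ R}, δ > 0 (compacta of the OPEN exterior: immune to the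
Aretakis instability, so extremal final holes are allowed), flat chart → η in C² on the flat slabs,
O = J⁺(ιX) ∩ I⁻(q.charted), every future-complete normalised null ray from the data in closure O,
honest growing radii with excised growing convergence and causal exhaustion, future-oriented chart
times (`CauchyDevelopment.IsLocSettling`). No genericity, no sub-extremality, nothing at the
horizon. Not implied by the Statement (all data vs generic) and does not imply it (no censorship, no
horizon uniformity, no |a| < M). Nearest sibling:
PhotonSphereChannels.ChannelsResolveTameDevelopmentsR (needs 'no extremal remnant' + tame outer
region, concludes C² up to r₊); here neither hypothesis, weaker conclusion. [d -/
@[route_item "route-FinalStateConjecture-SpectralSurfaceGravity"]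
def CensoredLocSettling : Prop :=
  ∀ (X : Type) [TopologicalSpace X] [ChartedSpace Literature.Geometry.Lorentzian.E3 X] [IsManifold (𝓡 3) ((⊤ : ℕ∞) : WithTop ℕ∞) X] [T2Space X] [SecondCountableTopology X] [ConnectedSpace X], ∀ D ∈ Literature.Geometry.Lorentzian.admissibleVacuumData X, ∀ 𝒟 : Literature.Geometry.Lorentzian.VacuumCauchyDevelopment D, 𝒟.IsMaximal → Summit.FinalStateConjecture.HasCompleteNullInfinity 𝒟.toCauchyDevelopment → ∃ (O : Set 𝒟.carrier) (q : Literature.Geometry.Lorentzian.QuasiFinalStateDecomposition 𝒟.toSpacetime O 2 ⊤), 𝒟.toCauchyDevelopment.IsLocSettling O q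

/-- item stmt-FinalStateConjecture-9937 · crux · rank 9 · open · by planner
why it might fail: Known in print (CBG 1969 Thm 3, Sbierski 2016; an unproved XL Literature fact) but typed over the REPAIRED prelude: IsMaximal asks EVERY typed VacuumCauchyDevelopment of D to embed; a rogue typed development — as over the first, uninhabited rendering (VacuumDevelopment.isEmpty) — would kill it.
sources: ChoquetBruhatGeroch1969CMP, Sbierski2016AHP, Ringstrom2009, Literature.Geometry.Lorentzian.CauchyProblemExistenceDefect
[support] every admissible datum has a maximal globally hyperbolic vacuum development, stated over
the repaired structure `VacuumCauchyDevelopment` (the corrected form of the deprecated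
`choquetBruhat_geroch_exists_mghd`, recorded in `CauchyProblemExistenceDefect`);
Choquet-Bruhat–Geroch 1969 Thm. 3, Sbierski 2016 Thm. 2.6. Known theorem; large formalisation;
shared by every route of this summit. [difficulty: XL] -/
@[route_item "route-FinalStateConjecture-SpectralSurfaceGravity"]
def MGHDExists : Prop :=
  ∀ (X : Type) [TopologicalSpace X] [ChartedSpace Literature.Geometry.Lorentzian.E3 X] [IsManifold (𝓡 3) ((⊤ : ℕ∞) : WithTop ℕ∞) X] [T2Space X] [SecondCountableTopology X] [ConnectedSpace X], ∀ D ∈ Literature.Geometry.Lorentzian.admissibleVacuumData X, ∃ 𝒟 : Literature.Geometry.Lorentzian.VacuumCauchyDevelopment D, 𝒟.IsMaximal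

-- earlier KerrCalibration (stmt-FinalStateConjecture-11039, replaced 2026-08-16T23:17:47Z -> stmt-FinalStateConjecture-17370): retired by None — let E4 := EuclideanSpace ℝ (Fin 4); let E3 := EuclideanSpace ℝ (Fin 3); let S2 := Metric.sphere (0 : E3) 1; ∀ [Literature.Geometry.Lorentzian.Kerr.Facts] (M a r₀ τ : ℝ) (hMa : Literature.Geometry.Lorentzian.Kerr.IsSubextremal M a), Literature.Geometry.Loren
/-- item stmt-FinalStateConjecture-17370 · support · rank 4 · open · by planner
why it might fail: '→' needs every positive C² supersolution level of the non-self-adjoint pencil to be ≤ λ₀ (Krein–Rutman + adjoint pairing) in the clock normalisation; '←' at a ≠ 0 needs Jaramillo's e^{2Q} transported to dt*(ℓ) = 1 with no factor; at |a| = M the KS horizon sections must be MOTS with θ_k < 0, λ₀ = 0.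
sources: Jaramillo2012, Mars2012, AnderssonMarsSimon2008, BoothFairhurst2007, doi:10.1002/cpa.3160470105, Wald1984GR
[crux] (card P3, the dictionary line κ ↦ λ₀ made exact) For Kerr with 0 < M, |a| ≤ M (sub-extremal
AND extremal; widened 2026-08-16 so that the extremal calibration λ₀ = κ(M,M) = 0 used by
HorizonSubextremal is delivered) in ingoing Kerr–Schild coordinates on {r > r₀}, 0 < r₀ < r₊, and
every τ: the horizon section S_τ = {t* = τ, r = r₊}, parametrised from the unit sphere by n ↦ (τ,
r₊n₀ − a n₁, r₊n₁ + a n₀, r₊n₂), is marginally trapped for a clock-normalised null pair (ℓ⁰ = 1,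
i.e. ℓ = the Hawking generator T + ω₊Φ; g(ℓ,k) = −2), and for every κ′ the null-inward pencil admits
a positive supersolution at level κ′ (a jointly C³ deformation with velocity −ψk, ψ > 0 — hence ψ ∈
C² and d/ds θ^{(ℓ)}|₀ = L[ψ] classically; refuter repair 2026-08-15, with C² families the '→' half
was false — d/ds θ^{(ℓ)} ≥ κ′(−θ^{(k)})ψ) IFF κ′ ≤ `Kerr.surfaceGravity M a` = √(M²−a²)/(r₊²+a²) (=
0 at |a| = M): the pencil eigenvalue of the Kerr horizon is its surface gravity (eigenfunction:
Jaramillo's e^{2λ} from the Hodge decomposition of the rotation 1-form). Hence κ_ql > 0 ⇔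
`Kerr.IsSubextremal` and κ_ql = 0 ⇔ extremal on exact Kerr (surfaceGravity_pos_iff,
IsExtremal.surfaceGravity_eq_zero); known conten -/
@[route_item "route-FinalStateConjecture-SpectralSurfaceGravity"]
def KerrCalibration : Prop :=
  let E4 := EuclideanSpace ℝ (Fin 4); let E3 := EuclideanSpace ℝ (Fin 3); let S2 := Metric.sphere (0 : E3) 1; ∀ [Literature.Geometry.Lorentzian.Kerr.Facts] (M a r₀ τ : ℝ) (hM : 0 < M), |a| ≤ M → 0 < r₀ → r₀ < Literature.Geometry.Lorentzian.Kerr.rPlus M a → ∀ [(Literature.Geometry.Lorentzian.Kerr.metric M a r₀).HasLeviCivita] hpb, ∃ (f : S2 → (Literature.Geometry.Lorentzian.Kerr.region a r₀)) (P : Literature.Geometry.Lorentzian.LorentzianMetric.NullNormalPair (𝓡 2) (Literature.Geometry.Lorentzian.Kerr.metric M a r₀) (Literature.Geometry.Lorentzian.Kerr.timeOrientation M a r₀ hM.le) f) (hf : (Literature.Geometry.Lorentzian.Kerr.metric M a r₀).IsSpacelikeImmersion (𝓡 2) f), (∀ n : S2, ((f n : (Literature.Geometry.Lorentzian.Kerr.region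 a r₀)) : E4) = Literature.Geometry.Lorentzian.E4.ofTimeSpace τ (WithLp.toLp 2 ![Literature.Geometry.Lorentzian.Kerr.rPlus M a * (n : E3) 0 - a * (n : E3) 1, Literature.Geometry.Lorentzian.Kerr.rPlus M a * (n : E3) 1 + a * (n : E3) 0, Literature.Geometry.Lorentzian.Kerr.rPlus M a * (n : E3) 2])) ∧ (∀ n, Literature.Geometry.Lorentzian.E4.time (P.L n) = 1) ∧ (Literature.Geometry.Lorentzian.Kerr.metric M a r₀).IsMarginallyTrapped hpb hf P ∧ ∀ κ' : ℝ, ((∃ (ψ : S2 → ℝ) (F : ℝ → S2 → (Literature.Geometry.Lorentzian.Kerr.region a r₀)) (Q : ∀ s, Literature.Geometry.Lorentzian.LorentzianMetric.NullNormalPair (𝓡 2) (Literature.Geometry.Lorentzian.Kerr.metric M a r₀) (Literature.Geometry.Lorentzian.Kerr.timeOrientation M a r₀ hM.le) (F s)) (hF : ∀ s, (Literature.Geometry.Lorentzian.Kerr.metric M a r₀).IsSpacelikeImmersion (𝓡 2) (F s)), F 0 = f ∧ (Q 0).L = P.L ∧ ContMDiff (𝓘(ℝ, ℝ).prod (𝓡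 2)) 𝓘(ℝ, E4) 3 (uncurry F) ∧ ContMDiff (𝓘(ℝ, ℝ).prod (𝓡 2)) 𝓘(ℝ, E4).tangent 0 (fun p : ℝ × S2 ↦ (Bundle.TotalSpace.mk' E4 (F p.1 p.2) ((Q p.1).L p.2) : TangentBundle 𝓘(ℝ, E4) (Literature.Geometry.Lorentzian.Kerr.region a r₀))) ∧ (∀ n, 0 < ψ n) ∧ (∀ n, mfderiv 𝓘(ℝ, ℝ) 𝓘(ℝ, E4) (fun s ↦ F s n) 0 1 = (-(ψ n)) • P.Lbar n) ∧ ∀ n, ∃ D : ℝ, HasDerivAt (fun s ↦ (Literature.Geometry.Lorentzian.Kerr.metric M a r₀).nullExpansion (F s) hpb (hF s) (Q s).L n) D 0 ∧ κ' * (-((Literature.Geometry.Lorentzian.Kerr.metric M a r₀).nullExpansion f hpb hf P.Lbar n)) * ψ n ≤ D) ↔ κ' ≤ Literature.Geometry.Lorentzian.Kerr.surfaceGravity M a)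

/-- item stmt-FinalStateConjecture-18352 · support · rank 9 · open · by planner
[support] COMPACTNESS UPGRADE AT THE HORIZON (routine; the seam's ∀-spacetime lemma). For every
time-oriented spacetime 𝓢, every boosted Kerr late chart `chart` (0 < M, |a| ≤ M, IsLateChart)
admitting a C⁴ EXTENSION Φ across r = r₊ to the rest-frame coordinate collar C = {t* > τ₀, |r − r₊|
< η} which reproduces the chart on C and whose pulled-back metric Φ^*g is C³-bounded on C ∩ {t* ≥
τ₁} (three of the fifteen clauses of a red-shifted collar; no MOTS, no κ, no field equations
needed), excised C² convergence of `chart` to Kerr on every shell {r₊+δ ≤ r ≤ R}, δ > 0, implies C²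
convergence on the truncated slab {t* = τ, r₊ < r ≤ r₊+δ₁} for some δ₁ > 0 (`truncDeviationCk …
(r₊+δ₁) τ → 0`). Proof sketch: on the two-sided collar the deviation (Φ^*g)∘(Λ⁻¹(x−c)) − g_{M,a} is
uniformly C³-bounded (Kerr–Schild Kerr is smooth and t*-independent near r₊ > 0); translate the
slabs to t* = 0; for each m ≤ 2 the family D^m(deviation)|slab is bounded and equi-Lipschitz at
small scales (chords stay in the two-sided collar), so by Arzelà–Ascoli every sequence τ_n → ∞ has a
uniformly convergent subsequence whose limit vanishes on {r > r₊} (hypothesis, shell by shell) hence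
on the closure; so the sup o -/
@[route_item "route-FinalStateConjecture-SpectralSurfaceGravity"]
def CollarCompactness : Prop :=
  ∀ (𝓢 : Literature.Geometry.Lorentzian.Spacetime.{0} 4) (Λ : Literature.Geometry.Lorentzian.lorentzGroup) (c : Literature.Geometry.Lorentzian.E4) (M a τ₀ : ℝ) (O : Set 𝓢.carrier) (chart : Literature.Geometry.Lorentzian.boostedKerrExterior Λ c M a → 𝓢.carrier), 0 < M → |a| ≤ M → 𝓢.IsLateChart (Literature.Geometry.Lorentzian.boostedKerrBackground Λ c M a) O τ₀ chart → (∃ (η B τ₁ : ℝ) (Φ : Literature.Geometry.Lorentzian.E4 → 𝓢.carrier), 0 < η ∧ let C : Set Literature.Geometry.Lorentzian.E4 := {z | τ₀ < z 0 ∧ |Literature.Geometry.Lorentzian.Kerr.radius a z - Literature.Geometry.Lorentzian.Kerr.rPlus M a| < η}; let gC : Literature.Geometry.Lorentzian.E4 → Literature.Geometry.Lorentzian.E4 →L[ℝ] Literature.Geometry.Lorentzian.E4 →L[ℝ] ℝ := fun z ↦ Literature.Geometry.Lorentzian.pullbackBilin (I := 𝓡 4) (I' := 𝓘(ℝ, Literature.Geometry.Lorentzian.E4))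 Φ 𝓢.metric.val z; ContMDiffOn 𝓘(ℝ, Literature.Geometry.Lorentzian.E4) (𝓡 4) 4 Φ C ∧ EqOn chart (Φ ∘ Literature.Geometry.Lorentzian.poincareInv Λ c ∘ Subtype.val) {x | Literature.Geometry.Lorentzian.poincareInv Λ c x ∈ C} ∧ Literature.Geometry.Lorentzian.supCkENorm {z ∈ C | τ₁ ≤ z 0} 3 gC ≤ ENNReal.ofReal B) → (∀ δ R : ℝ, 0 < δ → Tendsto (fun τ ↦ 𝓢.annularDeviationCk (Literature.Geometry.Lorentzian.boostedKerrBackground Λ c M a) chart 2 (Literature.Geometry.Lorentzian.Kerr.rPlus M a + δ) R τ) atTop (𝓝 0)) → ∃ δ₁ : ℝ, 0 < δ₁ ∧ Tendsto (fun τ ↦ 𝓢.truncDeviationCk (Literature.Geometry.Lorentzian.boostedKerrBackground Λ c M a) chart 2 (Literature.Geometry.Lorentzian.Kerr.rPlus M a + δ₁) τ) atTop (𝓝 0)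

/-- item stmt-FinalStateConjecture-18374 · support · rank 9 · open · by planner
[support] SPLIT GLUE of the deciding crux (crux-strategist 2026-08-17, BC2 redirect of the RESTATED
crux stmt-FinalStateConjecture-17368): the three pieces imply GenericRedShiftedSettling —
`GenericCensoredCollars → CensoredLocSettling → CollarCompactness → GenericRedShiftedSettling`.
PROVED: theorem
`Summit.FinalStateConjecture.FinalStateConjecture.Theorems.SpectralSurfaceGravity.genericRedShiftedSettling_of_subs`
(frame form: hypotheses = the three items' statements verbatim, conclusion = the body of
GenericRedShiftedSettling verbatim; lean check rc 0, 0 sorry, axioms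
propext/Classical.choice/Quot.sound; `example := (genericRedShiftedSettling_of_subs : _ → _ → _ →
Theses.SpectralSurfaceGravity.GenericRedShiftedSettling)` rc 0 in a scratch importing the route
module), committed as crux workfile
Summits/FinalStateConjecture/FinalStateConjecture/Cruxes/GenericRedShiftedSettling/GenericRedShiftedSettlingSplit.lean
(commit 5b42806a0f5a) and attached as evidence on stmt-17368; a prover closes this item by proposing
that file verbatim as Theorems/SpectralSurfaceGravityGenericRedShiftedSettlingSplit.lean (Theorems
is prover-only for planner seats; `route edit --split … --glue-by` was bou -/
@[route_item "route-FinalStateConjecture-SpectralSurfaceGravity"]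
def GenericRedShiftedSettlingOfPieces : Prop :=
  GenericCensoredCollars → CensoredLocSettling → CollarCompactness → GenericRedShiftedSettling

/-- item stmt-FinalStateConjecture-11041 · assembly · rank 1 · closed · proved by Summit.FinalStateConjecture.FinalStateConjecture.Theorems.SpectralSurfaceGravity.assembly_proof @ 741361b39a7a (prover) · by planner
sources: DafermosLuk2017, Christodoulou1999
[assembly] HorizonSubextremal → LinearRedShift → KerrCalibration → GenericRedShiftedSettling →
MGHDExists → FinalStateConjecture (the root-level statement of
Summits/FinalStateConjecture/FinalStateConjecture/Statement.lean). -/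
@[route_item "route-FinalStateConjecture-SpectralSurfaceGravity"]
def Assembly : Prop :=
  HorizonSubextremal → LinearRedShift → KerrCalibration → GenericRedShiftedSettling → MGHDExists → _root_.FinalStateConjecture

-- `Assembly` holds: proved by `Summit.FinalStateConjecture.FinalStateConjecture.Theorems.SpectralSurfaceGravity.assembly_proof` @ 741361b39a7a (its module imports this route file, so no `_holds` link can be stated here).

/-! D-0027 §2.1 — DECIDING THEOREM (planner-authored via `route open/edit --closes-file`; by planner-rbadge-FinalStateConjecture-SpectralSu-51245b37-0 2026-08-16T23:42:45Z):
its hypotheses are this route's items and its conclusion the sub-problem Statement (glue_lint), and it elaborates with this file. -/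

@[closes "route-FinalStateConjecture-SpectralSurfaceGravity"] theorem closes (h₁ : HorizonSubextremal) (_h₂ : LinearRedShift) (h₃ : GenericRedShiftedSettling)
    (h₄ : MGHDExists) : _root_.FinalStateConjecture := by
  intro X _ _ _ _ _ _
  -- Tame Christodoulou genericity is antitone in the exceptional set (pure logic: the same
  -- one-ended tame immersed witness family serves any weaker property). Q := the generic
  -- property of `GenericRedShiftedSettling`, P := the Statement's property.
  have mono : ∀ {𝓓 : Set (Literature.Geometry.Lorentzian.InitialDataSet (𝓡 3) X)}
      {P Q : Literature.Geometry.Lorentzian.InitialDataSet (𝓡 3) X → Prop}, (∀ D ∈ 𝓓, Q D → P D) →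
      Literature.Geometry.Lorentzian.InitialDataSet.IsTameChristodoulouGeneric 𝓓 Q 1 →
        Literature.Geometry.Lorentzian.InitialDataSet.IsTameChristodoulouGeneric 𝓓 P 1 := by
    intro 𝓓 P Q hQP hQ d hd
    obtain ⟨e, F, hF, himm, hF0, hinj, hmem, hgood⟩ := hQ d ⟨hd.1, fun h ↦ hd.2 (hQP d hd.1 h)⟩
    exact ⟨e, F, hF, himm, hF0, hinj, hmem,
      fun c hc hbad ↦ hgood c hc ⟨hmem c, fun h ↦ hbad.2 (hQP _ (hmem c) h)⟩⟩
  refine mono ?_ (h₃ X)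
  intro D hD hQ
  -- pointwise on admissible data: S (= MGHDExists) gives the anti-vacuity conjunct, Q the complete
  -- null infinity of every MGHD, and U (= HorizonSubextremal) upgrades Q's red-shifted-collar
  -- decomposition to the Statement's sub-extremal, rays-closed, exhaustive, future-oriented one.
  refine ⟨h₄ X D hD, fun 𝒟 h𝒟 ↦ ⟨(hQ 𝒟 h𝒟).1, ?_⟩⟩
  exact h₁ X D hD 𝒟 h𝒟 (hQ 𝒟 h𝒟).2

end Summit.FinalStateConjecture.FinalStateConjecture.Theses.SpectralSurfaceGravity
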